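import Literature.AlgebraicGeometry.HodgeTheory.HodgeTypeDimension
import Literature.AlgebraicGeometry.Motives.VarietiesProperProofs
import Literature.NumberTheory.Transcendental.ComplexFormsPullback
import Literature.NumberTheory.Transcendental.AnalytificationFunctorialityProofs
import Literature.Geometry.Kaehler.ManifoldFormsPullback
import Literature.Geometry.Manifold.ModelChange
import HarnessLib

/-!
# Pull-backs of classes of Hodge type `(k, 0)` to varieties of dimension `< k` vanish

Family `hodge`, layer `Literature/AlgebraicGeometry/HodgeTheory`. Companion to `HodgeTypeDimension`
(`IsOfHodgeType.eq_zero_of_lt_left`: an `m`-dimensional smooth projective `Y` carries no non-zero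
class of type `(k, 0)`, `k > m`) and `RationalHodgeClasses` (`HodgeModel`, `IsOfHodgeType`).
This file PROVES the functorial form of that vanishing, which is the step

  «as `dim X' < k`, we have for `r > k` `j̃^* η = 0` in `H⁰(X̃', Ω^r_{X̃'})`»

of C. Voisin, *Hodge Theory and Complex Algebraic Geometry II* (2003), proof of Thm. 10.17
(PDF p. 259), i.e. of Prop. 10.24 (supported case): **for a `ℂ`-morphism `f : Y ⟶ X` of smooth
projective varieties, `dim Y = m < k`, and a class `c ∈ Hᵏ(X(ℂ); ℂ)` of Hodge type `(k, 0)`, the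
pull-back `f^* c ∈ Hᵏ(Y(ℂ); ℂ)` is zero** (`IsOfHodgeType.map_eq_zero_of_lt_left`). Its printed
content is Voisin I, §7.3.2 («the pullback of [a closed form of type `(p,q)`] is still of type
`(p,q)`» — the tree's theorem `IsOfType.pullback`) and §2.3.1 (`Ω^{k,0} = Λᵏ Ω^{1,0} = 0` above
the dimension — the tree's `IsOfType.eq_zero_of_finrank_lt_left`).

## Why this is not a corollary of "pull-backs preserve Hodge types", and the proof

In the tree's encoding a class is of Hodge type `(p, q)` if for SOME Hodge model `A` of `X`
(analytification `A.carrier → X(ℂ)` charted on a model space `A.model ≅ ℂⁿ`, plus a de Rham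
comparison family `A.deRham` natural over the manifolds charted on `A.model`, plus the Hodge
decomposition) its pull-back to `A.carrier` lies in `A.deRham (H^{p,q}_dR)`. A general statement
"`f^*` maps `(p,q)`-classes of `X` to `(p,q)`-classes of `Y`" in this encoding must relate the
comparison family of a model of `X` (over `A.model`-manifolds, dimension `n`) to that of a model
of `Y` (over `B.model`-manifolds, dimension `m`), which needs an unprinted rigidity theorem for
natural de Rham comparisons (cf. `NaturalDeRhamComparisonRigidity`,
`hodgePQ_independent_of_hodgeModel`); the former named fact `hodgePQ_pullback_of_models` of
`CorrespondenceSupportedVanishing` asserted exactly that and was XL for this reason. The VANISHING,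
which is all that Prop. 10.24 needs, requires no such thing — only the naturality of the ONE
family `A.deRham`, along a map of `A.model`-manifolds:

1. `A.pullback c = A.deRham w` with `w ∈ H^{k,0}_dR(A.carrier)` (hypothesis); WLOG `k ≤ n`
   (otherwise `c = 0` by `IsOfHodgeType.eq_zero_of_lt_left`), so `m < k ≤ n`.
2. `f^an : B.carrier → A.carrier` (`HodgeModel.anMap`, for ANY Hodge model `B` of `Y`) is
   holomorphic — Serre, GAGA §2, the tree's theorem
   `IsAnalytification.mdifferentiable_comp_map_holds` — hence real `C^∞`.
3. The auxiliary manifold `N := B.carrier × ℝ^{2n-2m}`, RE-CHARTED on `A.model` along a real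
   linear isomorphism `B.model × ℝ^{2n-2m} ≃L[ℝ] A.model` (`Literature.Geometry.Manifold.Rechart`),
   is an `A.model`-manifold, and `g := f^an ∘ pr₁ : N → A.carrier` is `C^∞`.
4. On forms, `g^* ω = pr₁^* ((f^an)^* ω)` and `(f^an)^* ω` is of type `(k, 0)` on `B.carrier`
   (`IsOfType.pullback`), of complex dimension `m < k`, hence `0`
   (`IsOfType.eq_zero_of_finrank_lt_left`); so `g^*_dR` kills `H^{k,0}_dR(A.carrier) ∋ w`.
5. Naturality of `A.deRham` along `g` (`A.deRham_isNatural`; the pull-back calculus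
   `PullbackFacts` is the global instance of `Literature/Geometry/Kaehler/ManifoldFormsPullback`):
   `g^*(A.deRham w) = A.deRham (g^*_dR w) = 0`, i.e. `g^*(A.pullback c) = 0`.
6. `i : B.carrier → N`, `b ↦ (b, 0)`, has `g ∘ i = f^an`, so `(f^an)^*(A.pullback c) = 0`; and
   `(f^an)^* ∘ A.pullback = B.pullback ∘ f(ℂ)^*` (`A.toComplexPoints ∘ f^an = f(ℂ) ∘ B.toComplexPoints`),
   with `B.pullback` injective (a homeomorphism). Hence `f^* c = 0`.

No named fact is introduced; the hypotheses are the data `B : HodgeModel m Y` (supplied by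
consumers from `nonempty_hodgeModel`) and smooth projectivity of `Y`, `X` (for GAGA
functoriality). Consumer: `CorrespondenceSupportedVanishing` (Voisin II, Prop. 10.24, supported
case, for every Gysin formalism), where this theorem replaces the former hypothesis
`hodgePQ_pullback_of_models` (D-0026 review-split, 2026-08-15).

## References

* C. Voisin, *Hodge Theory and Complex Algebraic Geometry II* (2003), proof of Thm. 10.17,
  (10.9) (p. 259) and Prop. 10.24.
* C. Voisin, *Hodge Theory and Complex Algebraic Geometry I* (2002), §2.3.1, §7.3.2.
* J.-P. Serre, *Géométrie algébrique et géométrie analytique*, Ann. Inst. Fourier 6 (1956), §2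
  n°5 (fonctorialité de `X^h`).
-/

noncomputable section

open scoped Manifold ContDiff
open CategoryTheory Set
open Literature.NumberTheory.Transcendental (IsAnalytification complexDeRhamCohomology hodgePQ
  IsOfType cclosedSmoothForms)
open Literature.AlgebraicTopology.SingularHomology (singularCohomology)
open Literature.Geometry.Manifold (Rechart)

namespace Literature.AlgebraicGeometry.HodgeTheory

section HodgeTheory

variable {m n : ℕ} {Y X : Motives.SchemeOver ℂ}

/-! ### The analytified morphism between two Hodge models -/

namespace HodgeModel

/-- The map `f^an : Y^an → X^an` between the carriers of Hodge models `B` of `Y` and `A` of `X`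
induced by a `ℂ`-morphism `f : Y ⟶ X`: `(A.toComplexPoints)⁻¹ ∘ f(ℂ) ∘ B.toComplexPoints`
(Serre, GAGA §2 n°5: a regular map is a holomorphic map of the analytifications).
[cite: SerreGAGA1956, §2 n°5 (fonctorialité de X^h)] -/
def anMap (A : HodgeModel n X) (B : HodgeModel m Y) (f : Y ⟶ X) : B.carrier → A.carrier :=
  fun b ↦ A.isAnalytification.homeomorph.symm (Motives.AlgPoints.map f (B.toComplexPoints b))

variable (A : HodgeModel n X) (B : HodgeModel m Y) (f : Y ⟶ X)

/-- `f^an` lies over `f(ℂ)`: `A.toComplexPoints ∘ f^an = f(ℂ) ∘ B.toComplexPoints`.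
[cite: SerreGAGA1956, §2 n°5 (fonctorialité de X^h)] -/
theorem toComplexPoints_anMap (b : B.carrier) :
    A.toComplexPoints (anMap A B f b) = Motives.AlgPoints.map f (B.toComplexPoints b) := by
  change A.isAnalytification.homeomorph (A.isAnalytification.homeomorph.symm _) = _
  rw [Homeomorph.apply_symm_apply]

/-- `f^an` is continuous. [cite: SerreGAGA1956, §2 n°5 (fonctorialité de X^h)] -/
theorem continuous_anMap : Continuous (anMap A B f) :=
  A.isAnalytification.homeomorph.symm.continuous.comp
    ((Motives.AlgPoints.continuous_map f).comp B.isAnalytification.isHomeomorph.continuous)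

/-- **`f^an` is holomorphic** for `Y`, `X` smooth projective (Serre, GAGA §2 n°5, «si `f : X → Y`
est une application régulière, `f` est aussi une application holomorphe de `X^h` dans `Y^h`»; the
tree's theorem `IsAnalytification.mdifferentiable_comp_map_holds`, whose finiteness and smoothness
hypotheses follow from smooth projectivity). [cite: SerreGAGA1956, §2 n°5 (fonctorialité de X^h)] -/
theorem mdifferentiable_anMap (hY : Motives.IsSmoothProjective m Y)
    (hX : Motives.IsSmoothProjective n X) :
    MDifferentiable 𝓘(ℂ, B.model) 𝓘(ℂ, A.model) (anMap A B f) := by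
  haveI : AlgebraicGeometry.IsProper Y.hom := Motives.IsSmoothProjective.isProper_holds hY
  haveI : AlgebraicGeometry.IsProper X.hom := Motives.IsSmoothProjective.isProper_holds hX
  haveI := hY.smoothOfRelativeDimension
  haveI := hX.smoothOfRelativeDimension
  exact IsAnalytification.mdifferentiable_comp_map_holds B.isAnalytification A.isAnalytification f
    (anMap A B f) (funext (toComplexPoints_anMap A B f))

/-- `f^an` is real `C^∞` (holomorphic maps are `C^∞`, `MDifferentiable.contMDiff_real_of_complex`).
[cite: SerreGAGA1956, §2 n°5 (fonctorialité de X^h)] -/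
theorem contMDiff_anMap (hY : Motives.IsSmoothProjective m Y)
    (hX : Motives.IsSmoothProjective n X) :
    ContMDiff 𝓘(ℝ, B.model) 𝓘(ℝ, A.model) ∞ (anMap A B f) :=
  haveI : CompleteSpace A.model := FiniteDimensional.complete ℂ A.model
  (mdifferentiable_anMap A B f hY hX).contMDiff_real_of_complex

/-- **`(f^an)^* ∘ A.pullback = B.pullback ∘ f(ℂ)^*`** on singular cohomology (functoriality,
`A.toComplexPoints ∘ f^an = f(ℂ) ∘ B.toComplexPoints`). [cite: HatcherAT2002, §3.1] -/
theorem map_anMap_pullback (k : ℕ) (c : singularCohomology ℂ ℂ (Motives.ComplexPoints X) k) :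
    singularCohomology.map ℂ ℂ ⟨anMap A B f, continuous_anMap A B f⟩ k (A.pullback k c) =
      B.pullback k (singularCohomology.map ℂ ℂ (Motives.AlgPoints.mapContinuous (L := ℂ) f) k c) := by
  have hc : (⟨A.toComplexPoints, A.isAnalytification.isHomeomorph.continuous⟩ :
        C(A.carrier, Motives.ComplexPoints X)).comp ⟨anMap A B f, continuous_anMap A B f⟩ =
      (Motives.AlgPoints.mapContinuous (L := ℂ) f).comp
        ⟨B.toComplexPoints, B.isAnalytification.isHomeomorph.continuous⟩ :=
    ContinuousMap.ext fun b ↦ toComplexPoints_anMap A B f b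
  change (singularCohomology.map ℂ ℂ _ k ≫ singularCohomology.map ℂ ℂ _ k) c =
    (singularCohomology.map ℂ ℂ _ k ≫ singularCohomology.map ℂ ℂ _ k) c
  rw [← singularCohomology.map_comp, ← singularCohomology.map_comp, hc]

end HodgeModel

/-! ### The auxiliary `A.model`-manifold `Y^an × ℝ^{2n-2m}` -/

section Aux

variable (A : HodgeModel n X) (B : HodgeModel m Y)

/-- The real filler space `ℝ^{2n-2m}` making `B.model × ℝ^{2n-2m}` and `A.model` real vector
spaces of the same dimension `2n` (for `m ≤ n`; the `ℕ`-subtraction in the exponent is only used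
under that hypothesis, `finrank_model_prod_filler`). [folklore] -/
abbrev filler (_A : HodgeModel n X) (_B : HodgeModel m Y) : Type :=
  EuclideanSpace ℝ (Fin (2 * n - 2 * m))

/-- `dim_ℝ (B.model × ℝ^{2n-2m}) = dim_ℝ A.model` when `m ≤ n` (`dim_ℂ A.model = n`,
`dim_ℂ B.model = m` by `IsAnalytification.finrank_eq`). [folklore] -/
theorem finrank_model_prod_filler (hmn : m ≤ n) :
    Module.finrank ℝ (B.model × filler A B) = Module.finrank ℝ A.model := by
  rw [Module.finrank_prod, finrank_real_of_complex, finrank_real_of_complex,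
    A.isAnalytification.finrank_eq, B.isAnalytification.finrank_eq, finrank_euclideanSpace_fin]
  omega

/-- A real continuous linear isomorphism `B.model × ℝ^{2n-2m} ≃L[ℝ] A.model` (`m ≤ n`). [folklore] -/
def modelIso (hmn : m ≤ n) : (B.model × filler A B) ≃L[ℝ] A.model :=
  ContinuousLinearEquiv.ofFinrankEq (finrank_model_prod_filler A B hmn)

/-- The same isomorphism as a homeomorphism of model spaces `ModelProd B.model ℝ^{2n-2m} ≃ₜ A.model`
(the change of model for `Rechart`). [folklore] -/
def modelHomeomorph (hmn : m ≤ n) : ModelProd B.model (filler A B) ≃ₜ A.model :=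
  (modelIso A B hmn).toHomeomorph

/-- The change of model is `C^∞` (it is linear). [folklore] -/
theorem contMDiff_modelHomeomorph (hmn : m ≤ n) :
    ContMDiff (𝓘(ℝ, B.model).prod 𝓘(ℝ, filler A B)) 𝓘(ℝ, A.model) ∞ (modelHomeomorph A B hmn) :=
  Rechart.contMDiff_of_apply_eq_linear (modelHomeomorph A B hmn) (modelIso A B hmn) fun _ ↦ rfl

/-- The inverse change of model is `C^∞`. [folklore] -/
theorem contMDiff_modelHomeomorph_symm (hmn : m ≤ n) :
    ContMDiff 𝓘(ℝ, A.model) (𝓘(ℝ, B.model).prod 𝓘(ℝ, filler A B)) ∞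
      (modelHomeomorph A B hmn).symm :=
  Rechart.contMDiff_symm_of_apply_eq_linear (modelHomeomorph A B hmn) (modelIso A B hmn)
    fun _ ↦ rfl

/-- The auxiliary manifold `N = Y^an × ℝ^{2n-2m}` re-charted on `A.model`. [folklore] -/
abbrev Aux (hmn : m ≤ n) : Type :=
  Rechart (modelHomeomorph A B hmn) (B.carrier × filler A B)

/-- `N` is a real `C^∞` manifold charted on `A.model` (`Rechart.isManifold`). [folklore] -/
theorem isManifold_aux (hmn : m ≤ n) : IsManifold 𝓘(ℝ, A.model) ∞ (Aux A B hmn) :=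
  Rechart.isManifold _ _ (contMDiff_modelHomeomorph A B hmn) (contMDiff_modelHomeomorph_symm A B hmn)

/-- The projection `N → Y^an` is `C^∞` (identity of `Rechart` followed by `pr₁`). [folklore] -/
theorem contMDiff_fst_out (hmn : m ≤ n) :
    ContMDiff 𝓘(ℝ, A.model) 𝓘(ℝ, B.model) ∞
      (fun x : Aux A B hmn ↦ (Rechart.out (modelHomeomorph A B hmn) _ x).1) :=
  contMDiff_fst.comp
    (Rechart.contMDiff_out _ _ (contMDiff_modelHomeomorph A B hmn)
      (contMDiff_modelHomeomorph_symm A B hmn))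

/-- The inclusion `Y^an → N`, `b ↦ (b, 0)`, as a continuous map. [folklore] -/
def auxIncl (hmn : m ≤ n) : C(B.carrier, Aux A B hmn) :=
  ⟨fun b ↦ Rechart.into (modelHomeomorph A B hmn) _ (b, 0),
    (Rechart.continuous_into _ _).comp (continuous_id.prodMk continuous_const)⟩

end Aux

/-! ### The vanishing -/

/-- **Pull-backs of `(k, 0)`-classes to varieties of dimension `< k` vanish** (Voisin II, proof of
Thm. 10.17, (10.9): «as `dim X' < k`, we have for `r > k` `j̃^*η = 0` in `H⁰(X̃', Ω^r_{X̃'})`»).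
For smooth projective `Y` (dimension `m`, with a Hodge model `B`) and `X` (dimension `n`), a
`ℂ`-morphism `f : Y ⟶ X`, `m < k`, and `c ∈ Hᵏ(X(ℂ); ℂ)` of Hodge type `(k, 0)`:
`f^* c = 0` in `Hᵏ(Y(ℂ); ℂ)` (here `f^* = singularCohomology.map (f(ℂ))`, i.e. the tree's
`complexBetti.map f k`). Proof in the module docstring (holomorphic pull-back of `(k,0)`-forms to
`Y^an` vanishes; naturality of the comparison of the model `A` witnessing the type of `c` along
`Y^an × ℝ^{2n-2m} → X^an`, re-charted on `A.model`). The Hodge model `B` of `Y` is a datum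
(consumers obtain it from `nonempty_hodgeModel m Y`); nothing is assumed about its comparison.
[cite: VoisinHodgeII2003, proof of Thm. 10.17 (10.9)] [cite: VoisinHodgeI2002, §7.3.2 and §2.3.1] -/
theorem IsOfHodgeType.map_eq_zero_of_lt_left {k : ℕ}
    {c : singularCohomology ℂ ℂ (Motives.ComplexPoints X) k} (hc : IsOfHodgeType n X k k 0 c)
    (hY : Motives.IsSmoothProjective m Y) (hX : Motives.IsSmoothProjective n X) (B : HodgeModel m Y)
    (f : Y ⟶ X) (hk : m < k) :
    singularCohomology.map ℂ ℂ (Motives.AlgPoints.mapContinuous (L := ℂ) f) k c = 0 := by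
  rcases lt_or_ge n k with hnk | hkn
  · rw [hc.eq_zero_of_lt_left hnk, map_zero]
  obtain ⟨A, hA⟩ := hc
  have hmn : m ≤ n := hk.le.trans hkn
  -- (1) `A.pullback c = A.deRham w`, `w ∈ H^{k,0}_dR(A.carrier)`
  obtain ⟨w, hw, hwc⟩ := Submodule.mem_map.1 hA
  rw [LinearEquiv.coe_toLinearMap] at hwc
  -- (3) the auxiliary `A.model`-manifold and `g = f^an ∘ pr₁`
  haveI := isManifold_aux A B hmn
  set fan := HodgeModel.anMap A B f with hfan
  have hfan_smooth : ContMDiff 𝓘(ℝ, B.model) 𝓘(ℝ, A.model) ∞ fan :=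
    HodgeModel.contMDiff_anMap A B f hY hX
  set p : Aux A B hmn → B.carrier := fun x ↦ (Rechart.out (modelHomeomorph A B hmn) _ x).1 with hp
  have hp_smooth : ContMDiff 𝓘(ℝ, A.model) 𝓘(ℝ, B.model) ∞ p := contMDiff_fst_out A B hmn
  set g : Aux A B hmn → A.carrier := fan ∘ p with hg
  have hg_smooth : ContMDiff 𝓘(ℝ, A.model) 𝓘(ℝ, A.model) ∞ g := hfan_smooth.comp hp_smooth
  -- (4) `g^*` kills the forms of type `(k, 0)`
  have hforms : ∀ β : Literature.Geometry.Kaehler.MForm 𝓘(ℝ, A.model) A.carrier ℂ k,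
      IsOfType k 0 β → β.pullback 𝓘(ℝ, A.model) g = 0 := by
    intro β hβ
    have h0 : β.pullback 𝓘(ℝ, B.model) fan = 0 :=
      (hβ.pullback (HodgeModel.mdifferentiable_anMap A B f hY hX)).eq_zero_of_finrank_lt_left
        (by rw [B.isAnalytification.finrank_eq]; exact hk)
    rw [hg, Literature.Geometry.Kaehler.MForm.pullback_comp (hfan_smooth.mdifferentiable (by simp))
      (hp_smooth.mdifferentiable (by simp)), h0, Literature.Geometry.Kaehler.MForm.pullback_zero]
  have hker : hodgePQ A.model A.carrier k k 0 ≤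
      LinearMap.ker (complexDeRhamCohomology.map A.model hg_smooth k) := by
    rw [hodgePQ, Submodule.span_le]
    rintro _ ⟨α, hα, rfl⟩
    rw [SetLike.mem_coe, LinearMap.mem_ker, complexDeRhamCohomology.map_mk]
    have h0 : (⟨(α : Literature.Geometry.Kaehler.MForm 𝓘(ℝ, A.model) A.carrier ℂ k).pullback
        𝓘(ℝ, A.model) g, Literature.NumberTheory.Transcendental.pullback_mem_cclosedSmoothForms
          hg_smooth α.2⟩ : cclosedSmoothForms A.model (Aux A B hmn) k) = 0 :=
      Subtype.ext (hforms α hα)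
    rw [h0, map_zero]
  have hgw : complexDeRhamCohomology.map A.model hg_smooth k w = 0 := LinearMap.mem_ker.1 (hker hw)
  -- (5) naturality of `A.deRham` along `g`
  have hnat := A.deRham_isNatural (Aux A B hmn) A.carrier g hg_smooth k w
  rw [hgw, map_zero, hwc] at hnat
  -- `hnat : 0 = g^* (A.pullback c)`
  -- (6) restrict along `i : Y^an → N`, `g ∘ i = f^an`
  have hgi : (⟨g, hg_smooth.continuous⟩ : C(Aux A B hmn, A.carrier)).comp (auxIncl A B hmn) =
      ⟨fan, HodgeModel.continuous_anMap A B f⟩ :=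
    rfl
  have h2 : singularCohomology.map ℂ ℂ ⟨fan, HodgeModel.continuous_anMap A B f⟩ k
      (A.pullback k c) = 0 := by
    rw [← hgi, singularCohomology.map_comp, CategoryTheory.comp_apply, ← hnat, map_zero]
  apply B.pullback_injective k
  rw [← HodgeModel.map_anMap_pullback, map_zero]
  exact h2

end HodgeTheory

end Literature.AlgebraicGeometry.HodgeTheory

end
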